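import Literature.Computability.QuantumComplexity.BosonReductionMachine
import HarnessLib

/-!
# Exact BosonSampling: the canonical precision `gramPrecision X` in `FP`, and the reduction machine run at it

Family `quantum-advantage`; second of two brick files (with `BosonReductionDecode.lean`) behind the
discharge of `bosonReduction_mem_FP` (`ExactBosonSamplingHardness.lean`,
`ExactBosonSamplingHardnessProofs.lean`; Aaronson–Arkhipov, *The computational complexity of linear
optics*, Theory of Computing 9 (2013), proof of Thm. 1.1, p. 178, eqs. (4.20)–(4.23), and Lemma 4.4:
"`U` can be computed in polynomial time given `X`"). The reduction map `bosonPre` embeds the integer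
matrix `X` at the *canonical* precision `t = gramPrecision X = ⌊log₄ Σⱼ pairDiag X j⌋ + 1`, whereas the
machine of `BosonReductionMachine.lean` writes `gramInstanceCode (Matrix.of M) t` at `t = 3 |⟨M⟩|`
(`BosonFP.tOf`), a precision that enters only through the unary brick `BosonFP.tU`. This file

* computes the canonical precision on the machine's context `BosonFP.ctxOf M`: `sumDiagF` —
  `bin (Σ_{a<n} pairDiagN M a)`, a sum fold (`Brick.foldLoop addFn`) of the diagonal brick
  `BosonFP.pairDiagF`; `tBinF` — `bin t` with `t = (|bin Σ| ∸ 1) / 2 + 1` (`Brick.lenBinF`, `subFn`,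
  `divFn`, `addFn`), equal to `gramPrecision` by `log_four_eq_size` (`⌊log₄ N⌋ = (size N ∸ 1) / 2`);
  `tUF` — `1ᵗ` (a concatenation fold `BosonFP.cmapF` of single symbols);
* proves `tPrec_le_tOf` — **the canonical precision is at most the machine's**: `gramPrecision X ≤ 3 |⟨X⟩|`,
  because `Σ_a pairDiag ≤ n (2n + n³) 16^{|⟨X⟩|} < 4^{|⟨X⟩|} 16^{|⟨X⟩|}` (`2n + 4 ≤ |⟨X⟩|`), so that every
  size estimate of `BosonReductionMachine.lean` (cells of at most `3 |⟨M⟩| + 1` magnitude symbols, row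
  frames of at most `43 |⟨M⟩|²` symbols, blocks within the padded context) applies verbatim and the
  clipped loops again do not clip;
* re-runs the `t`-dependent part of the machine with `tUF` in place of `tU`: `pow4tP`, `defP`,
  `digitBitP`, `cellVP` (`bin 4ᵗ`, the deficits `bin (4ᵗ − pairDiagN a)`, the base-`4` digit test,
  the private cells), `rowsVlP`, `rowsVlvlP`, `partVP` (the private row block `partVs M (tPrec M)`),
  `eUP`, `x0P`, and **`bPreP`** with **`bPreP_apply`**:
  `bPreP (qcode M) = ⟨gramInstanceCode (Matrix.of M) (tPrec M), diagOutcomeCode n (tPrec M)⟩` — the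
  value of `bosonPre` on canonical codes — and `bPreP_mem_FP`. The `X`-block, the pair block and the
  outcome code are precision-free and reused (`partXF`, `partPF`, `y0F`).

## References

* S. Aaronson, A. Arkhipov, *The computational complexity of linear optics*, Theory of Computing 9
  (2013), Lemma 4.4 and proof of Thm. 1.1, eqs. (4.20)–(4.23) (p. 178).
* S. Arora, B. Barak, *Computational Complexity: A Modern Approach*, CUP 2009, §1.3 (polynomial
  time is closed under composition and polynomially bounded loops), §0.1 (codes of tuples).
-/

namespace Literature.Computability.QuantumComplexity

namespace BosonFP

open _root_.Computability Polynomial Literature.Computability.Complexity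
  Literature.Computability.Complexity.OracleCompose Literature.Computability.Complexity.Brick
  Literature.Computability.Complexity.Plumb Literature.Computability.Complexity.HashBricks BosonCodes Finset

variable {n : ℕ}

/-! ### The canonical precision as a function of the `ℕ`-indexed diagonal entries -/

/-- The sum of the diagonal Gram entries after the pair rows: `Σ_{a<n} pairDiagN M a`. [folklore] -/
def sumDiagN (M : Fin n → Fin n → ℤ) : ℕ := ∑ a ∈ range n, pairDiagN M a

/-- **The canonical precision** of the embedding of `M`: `gramPrecision (Matrix.of M)`. [folklore] -/
def tPrec (M : Fin n → Fin n → ℤ) : ℕ := gramPrecision (Matrix.of M)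

/-- `tPrec M = ⌊log₄ (sumDiagN M)⌋ + 1`. [folklore] -/
theorem tPrec_eq (M : Fin n → Fin n → ℤ) : tPrec M = Nat.log 4 (sumDiagN M) + 1 := by
  unfold tPrec gramPrecision sumDiagN
  congr 2
  rw [← Fin.sum_univ_eq_sum_range]
  refine Finset.sum_congr rfl fun a _ => ?_
  rw [← pairDiagN_eq, Int.toNat_natCast]

/-- **`⌊log₄ N⌋ = (size N ∸ 1) / 2`** (the number of binary digits determines the base-`4` logarithm). [folklore] -/
theorem log_four_eq_size (N : ℕ) : Nat.log 4 N = (Nat.size N - 1) / 2 := by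
  rcases Nat.eq_zero_or_pos N with rfl | hN
  · simp
  · set s := N.size with hs
    have hs0 : 0 < s := Nat.size_pos.2 hN
    have h1 : 2 ^ (s - 1) ≤ N := Nat.lt_size.1 (by omega)
    have h2 : N < 2 ^ s := Nat.lt_size_self N
    rw [Nat.log_eq_iff (Or.inr ⟨by norm_num, hN.ne'⟩)]
    constructor
    · calc 4 ^ ((s - 1) / 2) = 2 ^ (2 * ((s - 1) / 2)) := by rw [pow_mul]; norm_num
        _ ≤ 2 ^ (s - 1) := Nat.pow_le_pow_right (by norm_num) (by omega)
        _ ≤ N := h1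
    · calc N < 2 ^ s := h2
        _ ≤ 2 ^ (2 * ((s - 1) / 2 + 1)) := Nat.pow_le_pow_right (by norm_num) (by omega)
        _ = 4 ^ ((s - 1) / 2 + 1) := by rw [pow_mul]; norm_num

/-- `tPrec M = (|bin (sumDiagN M)| ∸ 1) / 2 + 1`. [folklore] -/
theorem tPrec_eq_size (M : Fin n → Fin n → ℤ) : tPrec M = ((encodeNat (sumDiagN M)).length - 1) / 2 + 1 := by
  rw [tPrec_eq, log_four_eq_size, TM2Pass.length_encodeNat_eq_size]

/-! ### The canonical precision is at most `3 |⟨M⟩|` -/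

/-- `2n + 4 ≤ |⟨M⟩|` (the binary and unary dimension headers). [folklore] -/
theorem two_mul_add_four_le_codeLen (M : Fin n → Fin n → ℤ) : 2 * n + 4 ≤ codeLen M := by
  rw [← length_qcode, qcode_eq, length_boolPair, length_boolPair]
  simp only [ones, List.length_replicate]
  omega

/-- Gram magnitudes: `|⟨x_a, x_k⟩| ≤ n 4^{|⟨M⟩|}`. [folklore] -/
theorem natAbs_gramAt_le (M : Fin n → Fin n → ℤ) (a k : Fin n) : (gramAt M a k).natAbs ≤ n * 4 ^ codeLen M := by
  have h := abs_colGram_le M a k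
  rw [← gramAt_eq, ← Int.natCast_natAbs] at h
  exact_mod_cast h

/-- **The diagonal entries are at most `(2n + n³) 16^{|⟨M⟩|}`.** [folklore] -/
theorem pairDiagN_le (M : Fin n → Fin n → ℤ) (a : Fin n) : pairDiagN M a ≤ (2 * n + n ^ 3) * 16 ^ codeLen M := by
  set L := codeLen M
  have h16 : (4 : ℕ) ^ L ≤ 16 ^ L := Nat.pow_le_pow_left (by norm_num) L
  have h1 : (1 : ℕ) ≤ 16 ^ L := Nat.one_le_pow _ _ (by norm_num)
  have hterm : ∀ k ∈ range n, (if (a : ℕ) < k then (gramAt M a k).natAbs ^ 2 else if k < (a : ℕ) then 1 else 0) ≤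
      n ^ 2 * 16 ^ L + 1 := by
    intro k hk
    have hk' : k < n := Finset.mem_range.1 hk
    split_ifs
    · have hg := natAbs_gramAt_le M a ⟨k, hk'⟩
      calc (gramAt M a k).natAbs ^ 2 ≤ (n * 4 ^ L) ^ 2 := Nat.pow_le_pow_left hg 2
        _ = n ^ 2 * 16 ^ L := by rw [mul_pow, ← pow_mul, show (4 : ℕ) ^ (L * 2) = 16 ^ L by rw [mul_comm, pow_mul]; norm_num]
        _ ≤ n ^ 2 * 16 ^ L + 1 := Nat.le_succ _
    · nlinarith
    · exact Nat.zero_le _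
  have hsum : ∑ k ∈ range n, (if (a : ℕ) < k then (gramAt M a k).natAbs ^ 2 else if k < (a : ℕ) then 1 else 0) ≤
      n * (n ^ 2 * 16 ^ L + 1) := by
    calc _ ≤ ∑ _k ∈ range n, (n ^ 2 * 16 ^ L + 1) := Finset.sum_le_sum hterm
      _ = n * (n ^ 2 * 16 ^ L + 1) := by rw [Finset.sum_const, Finset.card_range, smul_eq_mul]
  have hdiag : (gramAt M a a).natAbs ≤ n * 16 ^ L := (natAbs_gramAt_le M a a).trans (Nat.mul_le_mul_left n h16)
  unfold pairDiagN
  calc (gramAt M a a).natAbs + ∑ k ∈ range n, (if (a : ℕ) < k then (gramAt M a k).natAbs ^ 2 else if k < (a : ℕ) then 1 else 0)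
      ≤ n * 16 ^ L + n * (n ^ 2 * 16 ^ L + 1) := Nat.add_le_add hdiag hsum
    _ ≤ (2 * n + n ^ 3) * 16 ^ L := by nlinarith

/-- `2n² + n⁴ < 4^{2n + 4}`. [folklore] -/
theorem two_sq_add_pow_four_lt (n : ℕ) : n * (2 * n + n ^ 3) < 4 ^ (2 * n + 4) := by
  have h2 : n < 2 ^ n := Nat.lt_two_pow_self
  have h4 : n ^ 4 < 16 ^ n := by
    calc n ^ 4 < (2 ^ n) ^ 4 := Nat.pow_lt_pow_left h2 (by norm_num)
      _ = 16 ^ n := by rw [← pow_mul, mul_comm, pow_mul]; norm_num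
  have hn2 : n ^ 2 ≤ n ^ 4 := by
    rcases Nat.eq_zero_or_pos n with rfl | hn
    · simp
    · exact Nat.pow_le_pow_right hn (by norm_num)
  have e : (4 : ℕ) ^ (2 * n + 4) = 256 * 16 ^ n := by
    rw [pow_add, pow_mul]; norm_num; ring
  rw [e]
  nlinarith

/-- **`Σ_a pairDiagN M a < 4^{3 |⟨M⟩|}`.** [folklore] -/
theorem sumDiagN_lt (M : Fin n → Fin n → ℤ) : sumDiagN M < 4 ^ (3 * codeLen M) := by
  set L := codeLen M
  have hs : sumDiagN M ≤ n * ((2 * n + n ^ 3) * 16 ^ L) := by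
    unfold sumDiagN
    calc ∑ a ∈ range n, pairDiagN M a ≤ ∑ _a ∈ range n, (2 * n + n ^ 3) * 16 ^ L :=
          Finset.sum_le_sum fun a ha => pairDiagN_le M ⟨a, Finset.mem_range.1 ha⟩
      _ = n * ((2 * n + n ^ 3) * 16 ^ L) := by rw [Finset.sum_const, Finset.card_range, smul_eq_mul]
  have hL : 2 * n + 4 ≤ L := two_mul_add_four_le_codeLen M
  have hlt : n * (2 * n + n ^ 3) < 4 ^ L :=
    (two_sq_add_pow_four_lt n).trans_le (Nat.pow_le_pow_right (by norm_num) hL)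
  have e : (4 : ℕ) ^ (3 * L) = 4 ^ L * 16 ^ L := by
    rw [show 3 * L = L + 2 * L by ring, pow_add, pow_mul]; norm_num
  rw [e]
  calc sumDiagN M ≤ n * (2 * n + n ^ 3) * 16 ^ L := by rw [Nat.mul_assoc]; exact hs
    _ < 4 ^ L * 16 ^ L := Nat.mul_lt_mul_of_lt_of_le hlt le_rfl (by positivity)

/-- **The canonical precision is at most the machine's precision `tOf M = 3 |⟨M⟩|`.** [folklore] -/
theorem tPrec_le_tOf (M : Fin n → Fin n → ℤ) : tPrec M ≤ tOf M := by
  rw [tPrec_eq, tOf]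
  have h4 := four_le_codeLen M
  by_cases h0 : sumDiagN M = 0
  · rw [h0, Nat.log_zero_right]; omega
  · have h := Nat.log_lt_of_lt_pow h0 (sumDiagN_lt M)
    omega

/-- `1 ≤ tPrec M`. [folklore] -/
theorem one_le_tPrec (M : Fin n → Fin n → ℤ) : 1 ≤ tPrec M := by rw [tPrec_eq]; omega

/-- Size of the sum: `|bin Σ| ≤ 6 |⟨M⟩|`. [folklore] -/
theorem length_encodeNat_sumDiagN_le (M : Fin n → Fin n → ℤ) : (encodeNat (sumDiagN M)).length ≤ 6 * codeLen M := by
  rw [TM2Pass.length_encodeNat_eq_size, Nat.size_le]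
  calc sumDiagN M < 4 ^ (3 * codeLen M) := sumDiagN_lt M
    _ = 2 ^ (6 * codeLen M) := by rw [show (4 : ℕ) = 2 ^ 2 by norm_num, ← pow_mul]; ring_nf

/-- Size of a diagonal entry: `|bin (pairDiagN M a)| ≤ 6 |⟨M⟩|`. [folklore] -/
theorem length_encodeNat_pairDiagN_le (M : Fin n → Fin n → ℤ) (a : Fin n) :
    (encodeNat (pairDiagN M a)).length ≤ 6 * codeLen M := by
  refine le_trans ?_ (length_encodeNat_sumDiagN_le M)
  refine length_encodeNat_mono ?_
  unfold sumDiagN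
  exact Finset.single_le_sum (f := fun a => pairDiagN M a) (fun _ _ => Nat.zero_le _) (Finset.mem_range.2 a.isLt)

/-! ### The sum of the diagonal entries, the precision in binary and in unary, in `FP` -/

/-- The initial record of the sum loop: `⟨ctx, ⟨bin n, ⟨1⁰, bin 0⟩⟩⟩`. [folklore] -/
noncomputable def initSF : List Bool → List Bool := fanoutFn id (fanoutFn encN (fun _ => boolPair [] []))

/-- **`sumDiagF ctx = bin (Σ_a pairDiagN M a)`**: the sum fold of the diagonal brick. [folklore] -/
noncomputable def sumDiagF : List Bool → List Bool := sndPow 2 ∘ foldLoop addFn (clipF 7 pairDiagF) X ∘ initSF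

/-- Value of `sumDiagF`. [folklore] -/
@[simp] theorem sumDiagF_ctxOf (M : Fin n → Fin n → ℤ) : sumDiagF (ctxOf M) = encodeNat (sumDiagN M) := by
  have hinit : initSF (ctxOf M) = boolPair (ctxOf M) (boolPair (encodeNat n) (boolPair (ones 0) (encodeNat 0))) := by
    simp [initSF]; rfl
  have hL := codeLen_pow_le_length_ctxOf M
  have hk : n ≤ X.eval (ctxOf M).length := by simpa using (le_codeLen M).trans hL.1
  rw [sumDiagF, Function.comp_apply, Function.comp_apply, hinit, foldLoop_apply _ _ hk, sndPow_succ_boolPair,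
    sndPow_succ_boolPair, sndPow_zero_boolPair, foldAcc_clipF, foldAcc_addFn, Nat.zero_add, sumDiagN]
  · apply congrArg encodeNat
    exact sum_range_eq_of_fin _ _ fun a => by
      rw [Nat.zero_add, show boolPair (ctxOf M) (ones a) = gv M a from rfl, pairDiagF_apply, bitsToNat_encodeNat]
  · intro j _ hj
    rw [Nat.zero_add] at hj
    rw [show boolPair (ctxOf M) (ones j) = gv M j from rfl, pairDiagF_apply M ⟨j, hj⟩]
    have h := length_encodeNat_pairDiagN_le M ⟨j, hj⟩
    omega

/-- `sumDiagF ∈ FP`. [folklore] -/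
theorem sumDiagF_mem_FP : sumDiagF ∈ FP :=
  comp_mem_FP (sndPow_mem_FP 2) (comp_mem_FP (foldLoop_clipF_mem_FP 7 addFn_mem_FP length_addFn_le pairDiagF_mem_FP X)
    (fanoutFn_mem_FP id_mem_FP (fanoutFn_mem_FP accessors_mem_FP.1 (const_mem_FP _))))

/-- **`tBinF ctx = bin t`**, `t = (|bin Σ| ∸ 1) / 2 + 1 = gramPrecision`. [folklore] -/
noncomputable def tBinF : List Bool → List Bool :=
  addFn ∘ fanoutFn (divFn ∘ fanoutFn (subFn ∘ fanoutFn (lenBinF ∘ sumDiagF) (fun _ => [true]))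
    (fun _ => [false, true])) (fun _ => [true])

/-- Value of `tBinF`: the canonical precision in binary. [folklore] -/
@[simp] theorem tBinF_ctxOf (M : Fin n → Fin n → ℤ) : tBinF (ctxOf M) = encodeNat (tPrec M) := by
  have h1 : bitsToNat [true] = 1 := by simp
  have h2 : bitsToNat [false, true] = 2 := by simp
  rw [tPrec_eq_size]
  simp only [tBinF, Function.comp_apply, fanoutFn_apply, sumDiagF_ctxOf, lenBinF_apply, subFn_boolPair,
    bitsToNat_encodeNat, h1, divFn_boolPair, h2, addFn_boolPair]

/-- `tBinF ∈ FP`. [folklore] -/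
theorem tBinF_mem_FP : tBinF ∈ FP :=
  comp_mem_FP addFn_mem_FP (fanoutFn_mem_FP (comp_mem_FP divFn_mem_FP (fanoutFn_mem_FP
    (comp_mem_FP subFn_mem_FP (fanoutFn_mem_FP (comp_mem_FP lenBinF_mem_FP sumDiagF_mem_FP) (const_mem_FP _)))
    (const_mem_FP _))) (const_mem_FP _))

/-- A `ccat` of single `1`s is a unary string. [folklore] -/
theorem ccat_const_true : ∀ k : ℕ, ccat (fun _ => [true]) k = ones k
  | 0 => rfl
  | k + 1 => by
    rw [ccat_succ, ccat_const_true k]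
    simp [ones, List.replicate_succ']

/-- `t ≤ |ctx|` (indeed `t ≤ 3 |⟨M⟩| ≤ |⟨M⟩|³`). [folklore] -/
theorem tPrec_le_length_ctxOf (M : Fin n → Fin n → ℤ) : tPrec M ≤ (ctxOf M).length := by
  have h1 := tPrec_le_tOf M
  have h2 := codeLen_pow_le_length_ctxOf M
  have h4 := four_le_codeLen M
  rw [tOf] at h1
  have h3 : 3 * codeLen M ≤ codeLen M ^ 3 := by
    calc 3 * codeLen M ≤ codeLen M * codeLen M := Nat.mul_le_mul_right _ (by omega)
      _ ≤ codeLen M ^ 3 := by rw [pow_succ, sq]; exact Nat.le_mul_of_pos_right _ (by omega)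
  omega

/-- **`tUF ctx = 1ᵗ`**: the canonical precision in unary (a concatenation fold of single symbols,
counted by `tBinF`). [folklore] -/
noncomputable def tUF : List Bool → List Bool := cmapF tBinF (fun _ => [true]) 1

/-- Value of `tUF`. [folklore] -/
@[simp] theorem tUF_ctxOf (M : Fin n → Fin n → ℤ) : tUF (ctxOf M) = ones (tPrec M) := by
  rw [tUF, cmapF_apply (tBinF_ctxOf M) (tPrec_le_length_ctxOf M) (fun j _ => by simp), ccat_const_true]

/-- `tUF ∈ FP`. [folklore] -/
theorem tUF_mem_FP : tUF ∈ FP := cmapF_mem_FP 1 tBinF_mem_FP (const_mem_FP _)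

/-! ### The deficit `4ᵗ - pairDiag` and the base-4 digit test at the canonical precision -/

section Deficit

/-- On the context: `bin 4ᵗ = 0^{2t} 1`, `t = tPrec M`. [folklore] -/
noncomputable def pow4tP : List Bool → List Bool :=
  appF ∘ fanoutFn (Kannan.zerosFn ∘ onesMulFn 2 ∘ tUF) (fun _ => [true])

/-- `bin 4ᵗ`. [folklore] -/
theorem pow4tP_apply (M : Fin n → Fin n → ℤ) : pow4tP (ctxOf M) = encodeNat (4 ^ tPrec M) := by
  rw [show (4 : ℕ) ^ tPrec M = 2 ^ (2 * tPrec M) by rw [show (4 : ℕ) = 2 ^ 2 by norm_num, ← pow_mul],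
    Com.encodeNat_two_pow]
  simp [pow4tP, onesMulFn, ones]

/-- `pow4tP ∈ FP`. [folklore] -/
theorem pow4tP_mem_FP : pow4tP ∈ FP :=
  comp_mem_FP appF_mem_FP (fanoutFn_mem_FP
    (comp_mem_FP Kannan.zerosFn_mem_FP (comp_mem_FP (onesMulFn_mem_FP 2) tUF_mem_FP)) (const_mem_FP _))

/-- **The deficit `bin (4ᵗ - pairDiagN a)`** on `v = ⟨ctx, 1ᵃ⟩`, `t = tPrec M`. [folklore] -/
noncomputable def defP : List Bool → List Bool := subFn ∘ fanoutFn (pow4tP ∘ fstF) pairDiagF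

/-- Value of `defP`. [folklore] -/
@[simp] theorem defP_apply (M : Fin n → Fin n → ℤ) (a : Fin n) : defP (gv M a) = encodeNat (deficitN M (tPrec M) a) := by
  rw [defP, Function.comp_apply, fanoutFn_apply, Function.comp_apply, show fstF (gv M a) = ctxOf M by simp,
    pow4tP_apply, pairDiagF_apply, subFn_boolPair, bitsToNat_encodeNat, bitsToNat_encodeNat, deficitN]

/-- `defP ∈ FP`. [folklore] -/
theorem defP_mem_FP : defP ∈ FP :=
  comp_mem_FP subFn_mem_FP (fanoutFn_mem_FP (comp_mem_FP pow4tP_mem_FP fstF_mem_FP) pairDiagF_mem_FP)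

/-- On `r = ⟨⟨⟨ctx, 1ᵃ⟩, 1^{lvl}⟩, 1ˡ⟩`: the `lvl`-th base-`4` digit of the deficit of column `a` at the
canonical precision, `bin (d / 4^{lvl} % 4)`. [folklore] -/
noncomputable def digitP : List Bool → List Bool :=
  remFn ∘ fanoutFn (divFn ∘ fanoutFn (defP ∘ fstF ∘ fstF) pow4lvlF) (fun _ => [false, false, true])

/-- **The digit test** `[l < digit]` on `r` (one-bit), at the canonical precision. [folklore] -/
noncomputable def digitBitP : List Bool → List Bool := ltFn ∘ fanoutFn (lenBinF ∘ sndF) digitP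

/-- Value of the digit test. [folklore] -/
@[simp] theorem digitBitP_apply (M : Fin n → Fin n → ℤ) (a : Fin n) (lvl l : ℕ) :
    digitBitP (gr M a lvl l) = [decide (l < base4Digit (deficitN M (tPrec M) a) lvl)] := by
  have h4 : pow4lvlF (gr M a lvl l) = encodeNat (4 ^ lvl) := by
    rw [show (4 : ℕ) ^ lvl = 2 ^ (lvl + lvl) by rw [show (4 : ℕ) = 2 ^ 2 by norm_num, ← pow_mul]; ring_nf,
      Com.encodeNat_two_pow]
    simp [pow4lvlF]
  have hd : digitP (gr M a lvl l) = encodeNat (base4Digit (deficitN M (tPrec M) a) lvl) := by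
    have hdef : (defP ∘ fstF ∘ fstF) (gr M a lvl l) = encodeNat (deficitN M (tPrec M) a) := by simp
    have h3 : bitsToNat [false, false, true] = 4 := by decide
    rw [digitP, Function.comp_apply, fanoutFn_apply, Function.comp_apply, fanoutFn_apply, hdef, h4, divFn_boolPair,
      remFn_boolPair, bitsToNat_encodeNat, bitsToNat_encodeNat, bitsToNat_encodeNat, h3, base4Digit]
  rw [digitBitP, Function.comp_apply, fanoutFn_apply, Function.comp_apply, hd, lenBinF_apply, ltFn_boolPair,
    bitsToNat_encodeNat, bitsToNat_encodeNat]
  simp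

/-- `digitBitP ∈ FP`. [folklore] -/
theorem digitBitP_mem_FP : digitBitP ∈ FP :=
  comp_mem_FP ltFn_mem_FP (fanoutFn_mem_FP (comp_mem_FP lenBinF_mem_FP sndF_mem_FP)
    (comp_mem_FP remFn_mem_FP (fanoutFn_mem_FP (comp_mem_FP divFn_mem_FP (fanoutFn_mem_FP
      (comp_mem_FP defP_mem_FP (comp_mem_FP fstF_mem_FP fstF_mem_FP))
      (comp_mem_FP appF_mem_FP (fanoutFn_mem_FP (comp_mem_FP Kannan.zerosFn_mem_FP (comp_mem_FP appF_mem_FP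
        (fanoutFn_mem_FP (comp_mem_FP sndF_mem_FP fstF_mem_FP) (comp_mem_FP sndF_mem_FP fstF_mem_FP)))) (const_mem_FP _)))))
      (const_mem_FP _))))

end Deficit

/-! ### The private cells at the canonical precision -/

section Cells

/-- Cells of the private rows, on `⟨r, 1ʲ⟩` with `r = ⟨⟨⟨ctx, 1ᵃ⟩, 1^{lvl}⟩, 1ˡ⟩`: `intCode 2^{lvl}` in
column `a` when the digit test (at the canonical precision) passes, zero elsewhere. [folklore] -/
noncomputable def cellVP : List Bool → List Bool :=
  iteFn (andFn (eqPairFn ∘ fanoutFn sndF (sndF ∘ fstF ∘ fstF ∘ fstF)) (digitBitP ∘ fstF))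
    (fanoutFn (fanoutFn (fun _ => [false]) pow2lvlF) (fun _ => intCode 0)) (fun _ => cellCode 0)

/-- **Value of a private cell.** [folklore] -/
@[simp] theorem cellVP_apply (M : Fin n → Fin n → ℤ) (a j : Fin n) (lvl l : ℕ) :
    cellVP (boolPair (gr M a lvl l) (ones j)) = cellCode (cellVv M (tPrec M) a lvl l j) := by
  have h1 : (eqPairFn ∘ fanoutFn sndF (sndF ∘ fstF ∘ fstF ∘ fstF)) (boolPair (gr M a lvl l) (ones j)) =
      [decide ((j : ℕ) = a)] := by simp
  have h2 : (digitBitP ∘ fstF) (boolPair (gr M a lvl l) (ones j)) =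
      [decide (l < base4Digit (deficitN M (tPrec M) a) lvl)] := by simp
  have hc := andFn_apply h1 h2
  rw [cellVP, iteFn_apply hc]
  unfold cellVv
  by_cases h : (j : ℕ) = a ∧ l < base4Digit (deficitN M (tPrec M) a) lvl
  · obtain ⟨hja, hl⟩ := h
    rw [if_pos (by simp [hja, hl]), if_pos ⟨hja, hl⟩, cellCode, intCode_eq ((2 : ℤ) ^ lvl)]
    have e1 : decide ((2 : ℤ) ^ lvl < 0) = false := decide_eq_false (not_lt.2 (by positivity))
    have e2 : ((2 : ℤ) ^ lvl).natAbs = 2 ^ lvl := by rw [Int.natAbs_pow]; rfl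
    rw [e1, e2, Com.encodeNat_two_pow]
    simp [pow2lvlF]
  · rw [if_neg (by simpa [Bool.and_eq_true, decide_eq_true_eq, not_and] using (not_and.1 h)), if_neg h]

/-- `cellVP ∈ FP`. [folklore] -/
theorem cellVP_mem_FP : cellVP ∈ FP :=
  iteFn_mem_FP (andFn_mem_FP (comp_mem_FP eqPairFn_mem_FP (fanoutFn_mem_FP sndF_mem_FP
      (comp_mem_FP sndF_mem_FP (comp_mem_FP fstF_mem_FP (comp_mem_FP fstF_mem_FP fstF_mem_FP)))))
      (comp_mem_FP digitBitP_mem_FP fstF_mem_FP))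
    (fanoutFn_mem_FP (fanoutFn_mem_FP (const_mem_FP _) (comp_mem_FP appF_mem_FP (fanoutFn_mem_FP
      (comp_mem_FP Kannan.zerosFn_mem_FP (comp_mem_FP sndF_mem_FP (comp_mem_FP fstF_mem_FP fstF_mem_FP))) (const_mem_FP _))))
      (const_mem_FP _))
    (const_mem_FP _)

/-- **Private cell magnitudes are short** at the canonical precision (`lvl ≤ tPrec M ≤ 3 |⟨M⟩|`):
`|bin |z|| ≤ 3 |⟨M⟩| + 1`. [folklore] -/
theorem length_cellV_le (M : Fin n → Fin n → ℤ) (a j : Fin n) {lvl : ℕ} (l : ℕ) (hl : lvl ≤ tPrec M) :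
    (encodeNat (cellVv M (tPrec M) a lvl l j).natAbs).length ≤ 3 * codeLen M + 1 := by
  have ht := tPrec_le_tOf M
  unfold cellVv
  split_ifs
  · rw [Int.natAbs_pow, show (2 : ℤ).natAbs = 2 from rfl, Com.encodeNat_two_pow]
    simp [tOf] at ht ⊢; omega
  · exact Nat.zero_le _

end Cells

/-! ### The private row block at the canonical precision -/

section Blocks

/-- The private rows of a fixed `(a, lvl)` (on `⟨⟨ctx, 1ᵃ⟩, 1^{lvl}⟩`): the rows `(a, lvl, l)`, `l < 3`. [folklore] -/
noncomputable def rowsVlP : List Bool → List Bool :=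
  cmapF (fun _ => encodeNat 3) (rowFrF (fstF ∘ fstF ∘ fstF) cellVP 40) 43

/-- Value of `rowsVlP`. [folklore] -/
theorem rowsVlP_apply (M : Fin n → Fin n → ℤ) (a : Fin n) {lvl : ℕ} (hl : lvl ≤ tPrec M) :
    rowsVlP (boolPair (gv M a) (ones lvl)) = ccat (fun l => rowFrame n (cellVv M (tPrec M) a lvl l)) 3 := by
  have hL := codeLen_pow_le_length_ctxOf M
  have h4 := four_le_codeLen M
  have hlen : (ctxOf M).length ≤ (boolPair (gv M a) (ones lvl)).length := by rw [length_boolPair, length_boolPair]; omega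
  have hrow : ∀ l, l < 3 → rowFrF (fstF ∘ fstF ∘ fstF) cellVP 40 (boolPair (boolPair (gv M a) (ones lvl)) (ones l)) =
      rowFrame n (cellVv M (tPrec M) a lvl l) := by
    intro l _
    refine rowFrF_apply M (cellVv M (tPrec M) a lvl l) (by simp) ?_ (fun j => cellVP_apply M a j lvl l)
      (fun j => frame1_cell_le_ctx (length_cellV_le M a j l hl) ?_)
    · rw [length_boolPair, length_boolPair, length_boolPair]; have := le_codeLen M; omega
    · rw [length_boolPair, length_boolPair, length_boolPair]; omega
  rw [rowsVlP, cmapF_apply rfl (by rw [length_boolPair, length_boolPair]; omega)]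
  · exact ccat_congr hrow
  · intro l hl3
    rw [hrow l hl3]
    have h := length_rowFrame_le M (cellVv M (tPrec M) a lvl l) (fun j hj => length_cellV_le M a ⟨j, hj⟩ l hl)
    have := (sq_cube_le_ctx M hlen).1
    nlinarith

/-- The private rows of a fixed `a` (on `⟨ctx, 1ᵃ⟩`): the levels `lvl ≤ t`, `t = tPrec M`. [folklore] -/
noncomputable def rowsVlvlP : List Bool → List Bool := cmapF (lenBinF ∘ List.cons true ∘ tUF ∘ fstF) rowsVlP 129

/-- Value of `rowsVlvlP`. [folklore] -/
theorem rowsVlvlP_apply (M : Fin n → Fin n → ℤ) (a : Fin n) :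
    rowsVlvlP (gv M a) = ccat (fun lvl => ccat (fun l => rowFrame n (cellVv M (tPrec M) a lvl l)) 3) (tPrec M + 1) := by
  have hL := codeLen_pow_le_length_ctxOf M
  have h4 := four_le_codeLen M
  have ht := tPrec_le_tOf M
  rw [tOf] at ht
  have hlen : (ctxOf M).length ≤ (gv M a).length := by rw [length_boolPair]; omega
  have hcnt : (lenBinF ∘ List.cons true ∘ tUF ∘ fstF) (gv M a) = encodeNat (tPrec M + 1) := by simp
  have htl : tPrec M + 1 ≤ (gv M a).length := by
    rw [length_boolPair, length_ctxOf]
    nlinarith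
  rw [rowsVlvlP, cmapF_apply hcnt htl]
  · exact ccat_congr fun lvl hlvl => rowsVlP_apply M a (by omega)
  · intro lvl hlvl
    rw [rowsVlP_apply M a (by omega)]
    have h := length_ccat_le' (fun l => rowFrame n (cellVv M (tPrec M) a lvl l)) (43 * codeLen M ^ 2) 3 fun l _ =>
      length_rowFrame_le M _ (fun j hj => length_cellV_le M a ⟨j, hj⟩ l (by omega))
    have := (sq_cube_le_ctx M hlen).1
    nlinarith

/-- **The private block** (on the context) at the canonical precision: the private rows `(a, lvl, l)`. [folklore] -/
noncomputable def partVP : List Bool → List Bool := cmapF encN rowsVlvlP 430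

/-- `partVP ctx = partVs M (tPrec M)`. [folklore] -/
theorem partVP_ctxOf (M : Fin n → Fin n → ℤ) : partVP (ctxOf M) = partVs M (tPrec M) := by
  have hL := codeLen_pow_le_length_ctxOf M
  have h4 := four_le_codeLen M
  have ht := tPrec_le_tOf M
  rw [tOf] at ht
  rw [partVP, cmapF_apply (encN_ctxOf M) ((le_codeLen M).trans hL.1), partVs]
  · exact ccat_congr fun a ha => rowsVlvlP_apply M ⟨a, ha⟩
  · intro a ha
    rw [show boolPair (ctxOf M) (ones a) = gv M a from rfl, rowsVlvlP_apply M ⟨a, ha⟩]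
    have h := length_ccat_le' (fun lvl => ccat (fun l => rowFrame n (cellVv M (tPrec M) a lvl l)) 3)
      (3 * (43 * codeLen M ^ 2)) (tPrec M + 1) fun lvl hlvl =>
        length_ccat_le' _ _ 3 fun l _ => length_rowFrame_le M _
          (fun j hj => length_cellV_le M ⟨a, ha⟩ ⟨j, hj⟩ l (by omega))
    have h3 := (sq_cube_le_ctx M le_rfl).2
    have ht' : tPrec M + 1 ≤ 10 * codeLen M / 3 := by omega
    calc (ccat (fun lvl => ccat (fun l => rowFrame n (cellVv M (tPrec M) a lvl l)) 3) (tPrec M + 1)).length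
        ≤ (tPrec M + 1) * (3 * (43 * codeLen M ^ 2)) := h
      _ ≤ (10 * codeLen M) * (43 * codeLen M ^ 2) := by nlinarith
      _ = 430 * codeLen M ^ 3 := by ring
      _ ≤ 430 * ((ctxOf M).length + 1) := by nlinarith

/-- `partVP ∈ FP`. [folklore] -/
theorem partVP_mem_FP : partVP ∈ FP :=
  cmapF_mem_FP 430 accessors_mem_FP.1 (cmapF_mem_FP 129
    (comp_mem_FP lenBinF_mem_FP (comp_mem_FP (cons_mem_FP true) (comp_mem_FP tUF_mem_FP fstF_mem_FP)))
    (cmapF_mem_FP 43 (const_mem_FP _) (rowFrF_mem_FP 40 (comp_mem_FP fstF_mem_FP (comp_mem_FP fstF_mem_FP fstF_mem_FP))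
      cellVP_mem_FP)))

end Blocks

/-! ### The instance code at the canonical precision; the map `bPreP` -/

section Pre

/-- `1ᵉ`, `e = n² + 3 n (t + 1)`, `t = tPrec M` (on the context). [folklore] -/
noncomputable def eUP : List Bool → List Bool :=
  appF ∘ fanoutFn (umulFn ∘ fanoutFn onesN onesN) (umulFn ∘ fanoutFn onesN (onesMulFn 3 ∘ List.cons true ∘ tUF))

/-- `eUP ctx = 1ᵉ`. [folklore] -/
theorem eUP_ctxOf (M : Fin n → Fin n → ℤ) : eUP (ctxOf M) = ones (gramExtra n (tPrec M)) := by
  have h3 : (onesMulFn 3 ∘ List.cons true ∘ tUF) (ctxOf M) = ones (3 * (tPrec M + 1)) := by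
    simp [onesMulFn, ones]
  rw [eUP, Function.comp_apply, fanoutFn_apply, Function.comp_apply, Function.comp_apply, fanoutFn_apply,
    fanoutFn_apply, h3, onesN_ctxOf, umulFn_boolPair, umulFn_boolPair, appF_boolPair, gramExtra]
  simp only [ones, ← List.replicate_add]
  congr 1; ring

/-- `eUP ∈ FP`. [folklore] -/
theorem eUP_mem_FP : eUP ∈ FP :=
  comp_mem_FP appF_mem_FP (fanoutFn_mem_FP (comp_mem_FP umulFn_mem_FP (fanoutFn_mem_FP accessors_mem_FP.2.1 accessors_mem_FP.2.1))
    (comp_mem_FP umulFn_mem_FP (fanoutFn_mem_FP accessors_mem_FP.2.1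
      (comp_mem_FP (onesMulFn_mem_FP 3) (comp_mem_FP (cons_mem_FP true) tUF_mem_FP)))))

/-- The body of the row list at the canonical precision: the three blocks. [folklore] -/
noncomputable def bodyRowsP : List Bool → List Bool := appF ∘ fanoutFn (appF ∘ fanoutFn partXF partPF) partVP

/-- **The instance code** `x₀ = ⟨bin n, ⟨bin e, ⟨bin t, ⟨1^{n+e}, rows⟩⟩⟩⟩` at the canonical precision
(on the context). [folklore] -/
noncomputable def x0P : List Bool → List Bool :=
  fanoutFn encN (fanoutFn (lenBinF ∘ eUP) (fanoutFn tBinF (fanoutFn (appF ∘ fanoutFn onesN eUP) bodyRowsP)))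

/-- **`x0P ctx` is the instance code at the canonical precision `gramPrecision`.** [folklore] -/
theorem x0P_ctxOf (M : Fin n → Fin n → ℤ) : x0P (ctxOf M) = gramInstanceCode (Matrix.of M) (tPrec M) := by
  rw [gramInstanceCode_eq]
  simp only [x0P, bodyRowsP, fanoutFn_apply, Function.comp_apply, encN_ctxOf, eUP_ctxOf, lenBinF_apply, tBinF_ctxOf,
    onesN_ctxOf, appF_boolPair, partXF_ctxOf, partPF_ctxOf, partVP_ctxOf, ones, List.length_replicate,
    ← List.replicate_add]

/-- `x0P ∈ FP`. [folklore] -/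
theorem x0P_mem_FP : x0P ∈ FP :=
  fanoutFn_mem_FP accessors_mem_FP.1 (fanoutFn_mem_FP (comp_mem_FP lenBinF_mem_FP eUP_mem_FP)
    (fanoutFn_mem_FP tBinF_mem_FP
      (fanoutFn_mem_FP (comp_mem_FP appF_mem_FP (fanoutFn_mem_FP accessors_mem_FP.2.1 eUP_mem_FP))
        (comp_mem_FP appF_mem_FP (fanoutFn_mem_FP (comp_mem_FP appF_mem_FP (fanoutFn_mem_FP partXF_mem_FP partPF_mem_FP))
          partVP_mem_FP)))))

/-- The outcome code does not depend on the precision. [folklore] -/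
theorem diagOutcomeCode_irrel (n t t' : ℕ) : diagOutcomeCode n t = diagOutcomeCode n t' := by
  rw [diagOutcomeCode_eq, diagOutcomeCode_eq]

/-- **The reduction's pre-processing map at the canonical precision** `q ↦ ⟨x₀, y₀⟩`: pad the matrix
code to its context, then emit the instance code at `t = gramPrecision` and the outcome code (AA13
p. 178: "Let us feed `A` as input to `𝒪` and consider the probability `p_A` that `𝒪` outputs `1_n`").
[cite: AaronsonArkhipovToC2013, proof of Thm. 1.1 (p. 178)] -/
noncomputable def bPreP : List Bool → List Bool := fanoutFn x0P y0F ∘ mkCtx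

/-- **`bPreP` on a canonical matrix code**: the instance of `M` at precision `gramPrecision (Matrix.of M)`
and the planted outcome — the value of `bosonPre` (`ExactBosonSamplingHardness.lean`) there.
[cite: AaronsonArkhipovToC2013, proof of Thm. 1.1 (p. 178)] -/
theorem bPreP_apply (M : Fin n → Fin n → ℤ) :
    bPreP (qcode M) = boolPair (gramInstanceCode (Matrix.of M) (tPrec M)) (diagOutcomeCode n (tPrec M)) := by
  rw [bPreP, Function.comp_apply, mkCtx_qcode, fanoutFn_apply, x0P_ctxOf, y0F_ctxOf, diagOutcomeCode_irrel n (tOf M)]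

/-- **`bPreP ∈ FP`.** [cite: AroraBarak2009, §1.3 (polynomial time is closed under composition and bounded loops)] -/
theorem bPreP_mem_FP : bPreP ∈ FP := comp_mem_FP (fanoutFn_mem_FP x0P_mem_FP y0F_mem_FP) mkCtx_mem_FP

end Pre

end BosonFP

end Literature.Computability.QuantumComplexity
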